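import Literature.Barriers.AnomalousDissipation.ObukhovCorrsinThresholdBesov
import HarnessLib

/-!
# The Obukhov–Corrsin threshold, Nikol'skii corner: mean-square (`L²`-Besov) scalar regularity

Barrier-audit addendum (2026-08-17, gen 2, D-0021) to the named fact
`Literature.Barriers.AnomalousDissipation.DrivasElgindiIyerJeong2022_thm4`
(`Barriers/AnomalousDissipation/ObukhovCorrsinThreshold`, scope caveat (viii)). In the identity
(5.9) of Drivas–Elgindi–Iyer–Jeong 2022 the scalar meets itself twice and the velocity once, so
the sup-norm Hölder bounds on the SCALAR in Thm. 4 can be replaced by bounds on the Nikol'skii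
seminorm of its `L²` translation modulus, `[θ]_{B^β_{2,∞}} = sup_{h≠0} ‖θ(· + h) - θ‖_{L²}/‖h‖^β`
(`Literature.Analysis.FunctionSpaces.eBesovSupSeminorm β 2`), pairing by Cauchy–Schwarz:
`‖∇θ̄_ℓ‖_{L²} ≤ (C₁/ℓ)[θ]_{B^β_{2,∞}} ℓ^β` (CET (7) in `L²`),
`‖τ_ℓ(u,θ)‖_{L²} ≤ 2 [u]_α ℓ^α [θ]_{B^β_{2,∞}} ℓ^β` (the CET identity, Minkowski–Jensen), and
`∫ τ_ℓ(θ₀,θ₀) ≤ ∫ k_ℓ(y) ‖θ₀(· - y) - θ₀‖²_{L²} dy ≤ [θ₀]²_{B^β_{2,∞}} ℓ^{2β}`. Consequently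
Thm. 4 of the source holds — same exponent `κ^{(α+2β-1)/(α+1)}`, same constant — for
`u ∈ L¹(0,T; C^{0,α})` and scalars bounded in `L^∞(0,T; B^β_{2,∞})` (`B^β_{2,∞} ⊋ C^{0,β}` on the
torus), given only the qualitative continuity of the slices `θ(t)` (a.e. `t`) and of `θ₀` that the
tree's slice identity (`PassiveScalarEnergySlice`) is stated for. For the barrier this means that
spatial intermittency of the transported component (Hölder norms unbounded along the family while
a mean-square exponent `β > (1-α)/2` stays bounded) is not an evasion. This is the end
`(p,q) = (2,∞)` of the scale `θ ∈ B^β_{p,∞}`, `u ∈ B^α_{q,∞}`, `2/p + 1/q = 1`; the end `(∞,1)`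
is `ObukhovCorrsinThresholdBesov`, and the inviscid conservation theorem in the full scale is
Akramov–Wiedemann 2019, Thm. 1.

## Contents

* `NikolskiiCorner.lintegral_enorm_mul_le_two_two` — Hölder `L² · L² ⊂ L¹`;
* `NikolskiiCorner.eLpNorm_two_commutatorRemainder_le`, `NikolskiiCorner.eLpNorm_two_commutator_le`
  — the CET remainder and commutator in `L²`, sup modulus on one factor and `L²` modulus on the
  other;
* `NikolskiiCorner.integral_sq_sub_integral_convolution_sq_le_of_modulus` — the integrated
  cumulant `∫ θ² - ∫ (θ ⋆ k_ε)²` against the `L²` modulus;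
* `NikolskiiCorner.neg_integral_conv_mul_flux_le_of_sqModulus` — the slice bound
  (as `Torus.neg_integral_conv_mul_flux_le_of_holderWith`, `PassiveScalarHolderSlice`) with the
  scalar entering through its `L²` modulus;
* `two_mul_eScalarDissipation_le_nikolskii` — the bound (5.10) at fixed scale `ε`
  (as `DrivasElgindiIyerJeong2022_thm4.two_mul_eScalarDissipation_le`);
* `DrivasElgindiIyerJeong2022_thm4_nikolskii` — the theorem, same shape and constant as
  `DrivasElgindiIyerJeong2022_thm4_holds` (`scale_bound`).

## Mathlib / tree search

Tree: `TorusMollifierEstimates` (`lintegral_rpow_enorm_integral_smul_le`,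
`eLpNorm_integral_smul_le_mul`, `Torus.eLpNorm_convolution_kernel_sub_self_le`,
`Torus.eLpNorm_partialDeriv_convolution_kernel_le`, `Torus.eLpNorm_comp_sub_sub_le_eBesovSupSeminorm`),
`TorusCommutatorEstimate` (`Torus.convolution_mul_sub_mul_convolution`,
`Torus.aestronglyMeasurable_diff_mul_diff`), `TorusMollifierHolder` (sup-norm CET (6)),
`PassiveScalarHolderSlice` (`Torus.integral_mul_inner_gradient_conv_conv_eq_sum`),
`PassiveScalarEnergySlice` (`Torus.integral_conv_mul_flux_eq`), `BesovDifference`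
(`eBesovSupSeminorm`), `ObukhovCorrsinThresholdProofs` (`setLIntegral_Ioo_le_of_ae_le`,
`scale_bound`), `ObukhovCorrsinThresholdBesov` (the `L¹ × sup` pattern). Mathlib:
`eLpNorm_smul_le_mul_eLpNorm` with `ENNReal.HolderConjugate.instTwoTwo`; no mollifier
commutator estimates.

## References

* T. D. Drivas, T. M. Elgindi, G. Iyer, I.-J. Jeong, Arch. Ration. Mech. Anal. 243 (2022)
  1151–1180, Thm. 4 and its proof, §5, (5.8)–(5.10) (arXiv:1911.03271). Bib key `DrivasEtAl2022`.
* I. Akramov, E. Wiedemann, *Renormalization of active scalar equations*, Nonlinear Anal. 179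
  (2019) 254–269, Thm. 1 (arXiv:1805.05683). Bib key `AkramovWiedemann2019`.
* P. Constantin, W. E, E. S. Titi, Comm. Math. Phys. 165 (1994), 207–209, (6)–(11). Bib key
  `ConstantinETiti1994`.
-/

open MeasureTheory Set Filter Topology Function
open scoped ENNReal NNReal Convolution InnerProductSpace

noncomputable section

namespace Literature.Barriers.AnomalousDissipation

open Literature.Analysis Literature.Analysis.FunctionSpaces Literature.Analysis.FluidPDE

namespace NikolskiiCorner

variable {d : Type*} [Fintype d]

/-- Hölder `L² · L² ⊂ L¹` for real functions: `∫ |f g| ≤ ‖f‖_{L²} ‖g‖_{L²}`. [folklore] -/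
theorem lintegral_enorm_mul_le_two_two {X : Type*} [MeasurableSpace X] {μ : Measure X}
    {f g : X → ℝ} (hf : AEStronglyMeasurable f μ) (hg : AEStronglyMeasurable g μ) :
    ∫⁻ x, ‖f x * g x‖ₑ ∂μ ≤ eLpNorm f 2 μ * eLpNorm g 2 μ := by
  haveI : ENNReal.HolderTriple 2 2 1 := ENNReal.HolderConjugate.instTwoTwo
  have h := @eLpNorm_smul_le_mul_eLpNorm _ _ _ _ μ _ _ _ _ 2 2 1 g hg f hf _
  rw [eLpNorm_one_eq_lintegral_enorm] at h
  exact h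

/-- **The CET remainder in `L²` against a Hölder factor** (mixed form: sup modulus for `f`,
`L²` modulus for `g`): if `f ∈ C^a` with constant `C_f` and the `L²` translation modulus of `g`
at scale `ε` is at most `A_g`, then `‖r_ε(f,g)‖_{L²} ≤ C_f ε^a · A_g`,
`r_ε(f,g)(x) = ∫ k_ε(y) (f(x-y) - f(x)) (g(x-y) - g(x)) dy` (Minkowski–Jensen with the unit-mass
kernel). [folklore] -/
theorem eLpNorm_two_commutatorRemainder_le {f g : UnitAddTorus d → ℝ}
    (hfm : AEStronglyMeasurable f volume) {Cf a : ℝ≥0} (hf : HolderWith Cf a f)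
    (hgm : AEStronglyMeasurable g volume) {ε : ℝ} (hε : 0 < ε) (hε' : ε ≤ 1 / 4) {Ag : ℝ≥0∞}
    (hAg : ∀ y : UnitAddTorus d, ‖y‖ ≤ ε → eLpNorm (fun x => g (x - y) - g x) 2 volume ≤ Ag) :
    eLpNorm (fun x => ∫ y, Torus.kernel ε y * ((f (x - y) - f x) * (g (x - y) - g x))) 2 volume ≤
      ENNReal.ofReal (Cf * ε ^ (a : ℝ)) * Ag := by
  have h := eLpNorm_integral_smul_le_mul (F := ℝ) (Torus.continuous_kernel hε hε').aestronglyMeasurable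
    (Torus.aestronglyMeasurable_diff_mul_diff hfm hgm) one_le_two ENNReal.ofNat_ne_top
    (A := ENNReal.ofReal (Cf * ε ^ (a : ℝ)) * Ag) (Eventually.of_forall fun y hy => ?_)
  · rw [Torus.lintegral_enorm_kernel hε hε', one_mul] at h
    exact h
  · have hy' : ‖y‖ ≤ ε := (mem_ball_zero_iff.1 (Torus.support_kernel_subset hε hy)).le
    have hC0 : 0 ≤ (Cf : ℝ) * ε ^ (a : ℝ) := by positivity
    set C : ℝ := (Cf : ℝ) * ε ^ (a : ℝ) with hCdef
    have hpt : ∀ x, ‖(f (x - y) - f x) * (g (x - y) - g x)‖ ≤ ‖(C • fun x => g (x - y) - g x) x‖ := by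
      intro x
      have hfx : |f (x - y) - f x| ≤ C := Torus.abs_sub_le_of_holderWith_of_norm_le hf x hy'
      simp only [Pi.smul_apply, smul_eq_mul, Real.norm_eq_abs, abs_mul, abs_of_nonneg hC0]
      exact mul_le_mul_of_nonneg_right hfx (abs_nonneg _)
    have hsm : eLpNorm (C • fun x => g (x - y) - g x) 2 volume =
        ‖C‖ₑ * eLpNorm (fun x => g (x - y) - g x) 2 volume :=
      eLpNorm_const_smul C _ 2 volume
    calc eLpNorm (fun x => (f (x - y) - f x) * (g (x - y) - g x)) 2 volume
        ≤ eLpNorm (C • fun x => g (x - y) - g x) 2 volume := eLpNorm_mono hpt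
      _ = ‖C‖ₑ * eLpNorm (fun x => g (x - y) - g x) 2 volume := hsm
      _ ≤ ENNReal.ofReal C * Ag := by
          rw [Real.enorm_eq_ofReal hC0]
          gcongr
          exact hAg y hy'

/-- **The integrated scalar cumulant against the `L²` modulus** (DEIJ 2022, proof of Thm. 4, the
term `½ ∫ τ_ℓ(θ,θ) dx`, mean-square form): for continuous `f` whose `L²` translation modulus
at scale `ε` is at most `A < ∞`, `∫ f² - ∫ (f ⋆ k_ε)² ≤ A²` (`∫ f² = ∫ (f²) ⋆ k_ε` by unit
mass, the CET identity pointwise, `τ_ε(f,f) = r_ε(f,f) - (f - f ⋆ k_ε)² ≤ r_ε(f,f)`, and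
`∫ r_ε(f,f) ≤ ∫ k_ε(y) ‖f(· - y) - f‖²_{L²} dy ≤ A²` by Tonelli). [folklore] -/
theorem integral_sq_sub_integral_convolution_sq_le_of_modulus {f : UnitAddTorus d → ℝ}
    (hfc : Continuous f) {ε : ℝ} (hε : 0 < ε) (hε' : ε ≤ 1 / 4) {A : ℝ≥0∞} (hA' : A ≠ ⊤)
    (hA : ∀ y : UnitAddTorus d, ‖y‖ ≤ ε → eLpNorm (fun x => f (x - y) - f x) 2 volume ≤ A) :
    (∫ x, f x ^ 2) - ∫ x, (f ⋆ Torus.kernel ε) x ^ 2 ≤ A.toReal ^ 2 := by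
  have hk := Torus.isSmooth_kernel (d := d) hε hε'
  have hkc : Continuous (Torus.kernel (d := d) ε) := hk.continuous
  have hfi : Integrable f volume := hfc.integrable_unitAddTorus
  have hff : Integrable (fun x => f x * f x) volume := (hfc.mul hfc).integrable_unitAddTorus
  -- `∫ f² = ∫ (f²) ⋆ k`
  have hmass : ∫ x, f x ^ 2 = ∫ x, ((fun y => f y * f y) ⋆ Torus.kernel ε) x := by
    rw [integral_convolution (ContinuousLinearMap.lsmul ℝ ℝ) hff hkc.integrable_unitAddTorus,
      ContinuousLinearMap.lsmul_apply, Torus.integral_kernel hε hε', smul_eq_mul, mul_one]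
    exact integral_congr_ae (Eventually.of_forall fun x => sq (f x))
  have hAc : Continuous (f ⋆ Torus.kernel ε) := Torus.continuous_convolution hfi hkc
  have hB : Continuous ((fun y => f y * f y) ⋆ Torus.kernel ε) := Torus.continuous_convolution hff hkc
  have hA2 : Integrable (fun x => (f ⋆ Torus.kernel ε) x ^ 2) volume :=
    (hAc.pow 2 : Continuous fun x => (f ⋆ Torus.kernel ε) x ^ 2).integrable_unitAddTorus
  -- the remainder `r(x) = ∫ k(y) (f(x-y) - f x)²`
  set r : UnitAddTorus d → ℝ := fun x => ∫ y, Torus.kernel ε y * ((f (x - y) - f x) * (f (x - y) - f x))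
    with hr
  have hrm : AEStronglyMeasurable r volume := by
    have hΦ : AEStronglyMeasurable (uncurry fun x y : UnitAddTorus d =>
        Torus.kernel ε y * ((f (x - y) - f x) * (f (x - y) - f x)))
        ((volume : Measure (UnitAddTorus d)).prod volume) :=
      (hkc.aestronglyMeasurable.comp_snd (f := fun y : UnitAddTorus d => Torus.kernel ε y)).mul
        (Torus.aestronglyMeasurable_diff_mul_diff hfc.aestronglyMeasurable hfc.aestronglyMeasurable)
    exact hΦ.integral_prod_right'
  -- `∫⁻ ‖r‖ₑ ≤ A²` by Minkowski–Jensen with exponent `1`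
  have hr1 : ∫⁻ x, ‖r x‖ₑ ≤ A ^ 2 := by
    have hB1 : ∀ᵐ y ∂(volume : Measure (UnitAddTorus d)), Torus.kernel ε y ≠ 0 →
        ∫⁻ x, ‖(f (x - y) - f x) * (f (x - y) - f x)‖ₑ ^ (1 : ℝ) ≤ A ^ 2 := by
      refine Eventually.of_forall fun y hy => ?_
      have hy' : ‖y‖ ≤ ε := (mem_ball_zero_iff.1 (Torus.support_kernel_subset hε hy)).le
      have hfy : AEStronglyMeasurable (fun x => f (x - y) - f x) volume :=
        (hfc.aestronglyMeasurable.comp_quasiMeasurePreserving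
          (measurePreserving_sub_right volume y).quasiMeasurePreserving).sub hfc.aestronglyMeasurable
      calc ∫⁻ x, ‖(f (x - y) - f x) * (f (x - y) - f x)‖ₑ ^ (1 : ℝ)
          = ∫⁻ x, ‖(f (x - y) - f x) * (f (x - y) - f x)‖ₑ := by simp_rw [ENNReal.rpow_one]
        _ ≤ eLpNorm (fun x => f (x - y) - f x) 2 volume * eLpNorm (fun x => f (x - y) - f x) 2 volume :=
            lintegral_enorm_mul_le_two_two hfy hfy
        _ ≤ A * A := mul_le_mul' (hA y hy') (hA y hy')
        _ = A ^ 2 := (sq A).symm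
    have h := lintegral_rpow_enorm_integral_smul_le (F := ℝ) (μ := (volume : Measure (UnitAddTorus d)))
      hkc.aestronglyMeasurable
      (Torus.aestronglyMeasurable_diff_mul_diff hfc.aestronglyMeasurable hfc.aestronglyMeasurable)
      le_rfl hB1
    simp_rw [ENNReal.rpow_one, smul_eq_mul] at h
    rw [Torus.lintegral_enorm_kernel hε hε', one_mul] at h
    exact h
  have hri : Integrable r volume := by
    refine ⟨hrm, ?_⟩
    exact lt_of_le_of_lt hr1 (ENNReal.pow_lt_top (lt_top_iff_ne_top.2 hA'))
  have hrint : ∫ x, r x ≤ A.toReal ^ 2 := by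
    calc ∫ x, r x ≤ ∫ x, |r x| := integral_mono hri hri.abs fun x => le_abs_self _
      _ = (∫⁻ x, ‖r x‖ₑ).toReal := by
          rw [← integral_norm_eq_lintegral_enorm hrm]
          rfl
      _ ≤ (A ^ 2).toReal := ENNReal.toReal_mono (ENNReal.pow_ne_top hA') hr1
      _ = A.toReal ^ 2 := ENNReal.toReal_pow A 2
  -- pointwise: `(f²) ⋆ k - (f ⋆ k)² = r - (f - f ⋆ k)² ≤ r`
  have hpt : ∀ x, ((fun y => f y * f y) ⋆ Torus.kernel ε) x - (f ⋆ Torus.kernel ε) x ^ 2 ≤ r x := by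
    intro x
    have hcet := Torus.convolution_mul_sub_mul_convolution hfi hfi hff hε hε' x
    rw [sq, hcet]
    nlinarith [mul_self_nonneg (f x - (f ⋆ Torus.kernel ε) x)]
  rw [hmass, ← integral_sub hB.integrable_unitAddTorus hA2]
  exact (integral_mono (hB.integrable_unitAddTorus.sub hA2) hri hpt).trans hrint

/-- **The Constantin–E–Titi commutator in `L²`** (mixed form: Hölder for `f`, `L²` modulus for
`g`): for continuous `f ∈ C^a` (constant `C_f`) and continuous `g` whose `L²` translation modulus
at scale `ε` is at most `A_g`,
`‖(fg) ⋆ k_ε - (f ⋆ k_ε)(g ⋆ k_ε)‖_{L²} ≤ 2 C_f ε^a A_g` (the CET identity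
`τ = r_ε(f,g) - (f - f ⋆ k_ε)(g - g ⋆ k_ε)`, the `L²` remainder bound, CET (6) in sup norm
for `f` and in `L²` for `g`). [folklore] -/
theorem eLpNorm_two_commutator_le {f g : UnitAddTorus d → ℝ} (hfi : Integrable f volume)
    {Cf a : ℝ≥0} (hf : HolderWith Cf a f) (hgc : Continuous g)
    (hfg : Integrable (fun x => f x * g x) volume) {ε : ℝ} (hε : 0 < ε) (hε' : ε ≤ 1 / 4)
    {Ag : ℝ≥0∞}
    (hAg : ∀ y : UnitAddTorus d, ‖y‖ ≤ ε → eLpNorm (fun x => g (x - y) - g x) 2 volume ≤ Ag) :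
    eLpNorm (fun x => ((fun y => f y * g y) ⋆ Torus.kernel ε) x -
        (f ⋆ Torus.kernel ε) x * (g ⋆ Torus.kernel ε) x) 2 volume ≤
      2 * (ENNReal.ofReal (Cf * ε ^ (a : ℝ)) * Ag) := by
  have hk := Torus.continuous_kernel (d := d) hε hε'
  have hgi : Integrable g volume := hgc.integrable_unitAddTorus
  have hC0 : 0 ≤ (Cf : ℝ) * ε ^ (a : ℝ) := by positivity
  set C : ℝ := (Cf : ℝ) * ε ^ (a : ℝ) with hCdef
  set r : UnitAddTorus d → ℝ := fun x => ∫ y, Torus.kernel ε y * ((f (x - y) - f x) * (g (x - y) - g x))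
    with hr
  set ef : UnitAddTorus d → ℝ := fun x => f x - (f ⋆ Torus.kernel ε) x with hef
  set eg : UnitAddTorus d → ℝ := fun x => g x - (g ⋆ Torus.kernel ε) x with heg
  have hfk : Continuous (f ⋆ Torus.kernel ε) := Torus.continuous_convolution hfi hk
  have hgk : Continuous (g ⋆ Torus.kernel ε) := Torus.continuous_convolution hgi hk
  have hrm : AEStronglyMeasurable r volume := by
    have hΦ : AEStronglyMeasurable (uncurry fun x y : UnitAddTorus d =>
        Torus.kernel ε y * ((f (x - y) - f x) * (g (x - y) - g x)))
        ((volume : Measure (UnitAddTorus d)).prod volume) :=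
      (hk.aestronglyMeasurable.comp_snd (f := fun y : UnitAddTorus d => Torus.kernel ε y)).mul
        (Torus.aestronglyMeasurable_diff_mul_diff hfi.aestronglyMeasurable hgc.aestronglyMeasurable)
    exact hΦ.integral_prod_right'
  have hefm : AEStronglyMeasurable ef volume := hfi.aestronglyMeasurable.sub hfk.aestronglyMeasurable
  have hegc : Continuous eg := hgc.sub hgk
  -- the identity, as functions
  have hfun : (fun x => ((fun y => f y * g y) ⋆ Torus.kernel ε) x -
      (f ⋆ Torus.kernel ε) x * (g ⋆ Torus.kernel ε) x) = r - fun x => ef x * eg x := by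
    funext x
    rw [Torus.convolution_mul_sub_mul_convolution hfi hgi hfg hε hε' x]
    rfl
  -- the remainder
  have h1 : eLpNorm r 2 volume ≤ ENNReal.ofReal C * Ag :=
    eLpNorm_two_commutatorRemainder_le hfi.aestronglyMeasurable hf hgc.aestronglyMeasurable hε hε' hAg
  -- the product of the two errors
  have h2 : eLpNorm (fun x => ef x * eg x) 2 volume ≤ ENNReal.ofReal C * Ag := by
    have hpt : ∀ x, ‖ef x * eg x‖ ≤ ‖(C • eg) x‖ := by
      intro x
      have hfx : |ef x| ≤ C := by
        rw [hef]
        dsimp only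
        rw [abs_sub_comm]
        exact Torus.abs_convolution_kernel_sub_self_le hfi hf hε hε' x
      simp only [Pi.smul_apply, smul_eq_mul, Real.norm_eq_abs, abs_mul, abs_of_nonneg hC0]
      exact mul_le_mul_of_nonneg_right hfx (abs_nonneg _)
    have heg2 : eLpNorm eg 2 volume ≤ Ag := by
      have h := Torus.eLpNorm_convolution_kernel_sub_self_le hgi hε hε' (p := 2) one_le_two
        ENNReal.ofNat_ne_top hAg
      rw [← eLpNorm_neg]
      convert h using 2
      funext x
      simp [heg]
    calc eLpNorm (fun x => ef x * eg x) 2 volume ≤ eLpNorm (C • eg) 2 volume := eLpNorm_mono hpt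
      _ = ‖C‖ₑ * eLpNorm eg 2 volume := eLpNorm_const_smul C _ 2 volume
      _ ≤ ENNReal.ofReal C * Ag := by
          rw [Real.enorm_eq_ofReal hC0]
          gcongr
  rw [hfun]
  calc eLpNorm (r - fun x => ef x * eg x) 2 volume
      ≤ eLpNorm r 2 volume + eLpNorm (fun x => ef x * eg x) 2 volume :=
        eLpNorm_sub_le hrm (hefm.mul hegc.aestronglyMeasurable) one_le_two
    _ ≤ ENNReal.ofReal C * Ag + ENNReal.ofReal C * Ag := add_le_add h1 h2
    _ = 2 * (ENNReal.ofReal C * Ag) := by rw [two_mul]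

/-! ## The slice bound with an `L²` translation modulus on the scalar -/

section Slice

variable [DecidableEq d] {δ : UnitAddTorus d → ℝ} {v : UnitAddTorus d → EuclideanSpace ℝ d} {ε Cv : ℝ}

/-- **The slice bound, Nikol'skii corner** (barrier audit 2026-08-17, scope caveat (viii) of
`DrivasElgindiIyerJeong2022_thm4`): as `Torus.neg_integral_conv_mul_flux_le_of_holderWith`, but
the Hölder hypothesis on the (continuous) scalar slice `δ` is replaced by a bound on its `L²`
translation modulus at scale `ε`, `‖δ(· - y) - δ‖_{L²} ≤ C_θ ε^β` for `‖y‖ ≤ ε` (which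
`[δ]_{B^β_{2,∞}} ≤ C_θ` gives): `-∫ A G ≤ d · P · Q + κ · d · P²` with the same
`P = (C₁/ε) C_θ ε^β ≥ ‖∂ⱼA‖_{L²}` and `Q = 2 C_u ε^α C_θ ε^β ≥ ‖τⱼ‖_{L²}` — the flux in
commutator form `∑ⱼ ∫ ∂ⱼA τⱼ` is paired by Cauchy–Schwarz instead of `sup × L¹`, and
`∫ ‖∇A‖² = ∑ⱼ ‖∂ⱼA‖²_{L²}`. [folklore] -/
theorem neg_integral_conv_mul_flux_le_of_sqModulus (hδ : Continuous δ) {Cθ β : ℝ≥0}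
    (hδN : ∀ y : UnitAddTorus d, ‖y‖ ≤ ε →
      eLpNorm (fun x => δ (x - y) - δ x) 2 volume ≤ ENNReal.ofReal (Cθ * ε ^ (β : ℝ)))
    (hv : AEStronglyMeasurable v volume) (hCv : ∀ y, ‖v y‖ ≤ Cv)
    {Cu α : ℝ≥0} (hvH : HolderWith Cu α v) (hdiv : FunctionSpaces.Torus.IsWeaklyDivFree v)
    (hε : 0 < ε) (hε' : ε ≤ 1 / 4) {κ : ℝ} (hκ : 0 ≤ κ) :
    -(∫ x, (δ ⋆ FunctionSpaces.Torus.kernel ε) x * ∫ y, δ y *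
        (-⟪v y, FunctionSpaces.Torus.gradient (FunctionSpaces.Torus.kernel ε) (x - y)⟫_ℝ +
          κ * FunctionSpaces.Torus.laplacian (FunctionSpaces.Torus.kernel ε) (x - y))) ≤
      Fintype.card d * (ε⁻¹ * FunctionSpaces.Torus.gradProfileMass d * (Cθ * ε ^ (β : ℝ))) *
          (2 * (Cu * ε ^ (α : ℝ) * (Cθ * ε ^ (β : ℝ)))) +
        κ * (Fintype.card d * (ε⁻¹ * FunctionSpaces.Torus.gradProfileMass d * (Cθ * ε ^ (β : ℝ))) ^ 2) := by
  set k : UnitAddTorus d → ℝ := FunctionSpaces.Torus.kernel ε with hk_def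
  have hk : FunctionSpaces.Torus.IsSmooth k := FunctionSpaces.Torus.isSmooth_kernel hε hε'
  have hkc : Continuous k := hk.continuous
  have hδi : Integrable δ volume := hδ.integrable_unitAddTorus
  have hA : FunctionSpaces.Torus.IsSmooth (δ ⋆ k) := FunctionSpaces.Torus.isSmooth_convolution hδi hk
  have hA1 : FunctionSpaces.Torus.IsContDiff 1 (δ ⋆ k) := hA.isContDiff (by simp)
  have hvI := fun j => Torus.integrable_apply_mul_of_norm_le hδ hv hCv j
  rw [Torus.integral_conv_mul_flux_eq hδi hv (Eventually.of_forall hCv) hε hε' κ, neg_sub]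
  set P : ℝ := ε⁻¹ * FunctionSpaces.Torus.gradProfileMass d * (Cθ * ε ^ (β : ℝ)) with hP
  set Q : ℝ := 2 * (Cu * ε ^ (α : ℝ) * (Cθ * ε ^ (β : ℝ))) with hQ
  have hθ0 : 0 ≤ (Cθ : ℝ) * ε ^ (β : ℝ) := by positivity
  have hP0 : 0 ≤ P :=
    mul_nonneg (mul_nonneg (inv_nonneg.2 hε.le) FunctionSpaces.Torus.gradProfileMass_nonneg) hθ0
  have hQ0 : 0 ≤ Q := by positivity
  -- `‖∂ⱼA‖_{L²} ≤ P`
  have hPj : ∀ j, eLpNorm (FunctionSpaces.Torus.partialDeriv j (δ ⋆ k)) 2 volume ≤ ENNReal.ofReal P := by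
    intro j
    have h := FunctionSpaces.Torus.eLpNorm_partialDeriv_convolution_kernel_le hδi hε hε' (p := 2)
      one_le_two ENNReal.ofNat_ne_top hδN j
    rw [hP, ENNReal.ofReal_mul (mul_nonneg (inv_nonneg.2 hε.le) FunctionSpaces.Torus.gradProfileMass_nonneg)]
    exact h
  -- `‖τⱼ‖_{L²} ≤ Q`
  have hQ' : ENNReal.ofReal Q = 2 * (ENNReal.ofReal (Cu * ε ^ (α : ℝ)) * ENNReal.ofReal (Cθ * ε ^ (β : ℝ))) := by
    rw [hQ, ENNReal.ofReal_mul zero_le_two, ENNReal.ofReal_ofNat, ENNReal.ofReal_mul (by positivity)]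
  have hτ : ∀ j, eLpNorm (fun x => ((fun y => v y j * δ y) ⋆ k) x -
      ((fun y => v y j) ⋆ k) x * (δ ⋆ k) x) 2 volume ≤ ENNReal.ofReal Q := by
    intro j
    rw [hQ']
    exact eLpNorm_two_commutator_le (hvI j).2.1 (FunctionSpaces.Torus.holderWith_apply hvH j) hδ
      (hvI j).2.2 hε hε' hδN
  -- (a) the transport pairing, by Cauchy–Schwarz
  have ha : |∫ y, δ y * ⟪v y, FunctionSpaces.Torus.gradient ((δ ⋆ k) ⋆ k) y⟫_ℝ| ≤ Fintype.card d * P * Q := by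
    rw [Torus.integral_mul_inner_gradient_conv_conv_eq_sum hδ hv hCv hdiv hε hε']
    refine (Finset.abs_sum_le_sum_abs _ _).trans ?_
    have hj : ∀ j, |∫ x, FunctionSpaces.Torus.partialDeriv j (δ ⋆ k) x *
        (((fun y => v y j * δ y) ⋆ k) x - ((fun y => v y j) ⋆ k) x * (δ ⋆ k) x)| ≤ P * Q := by
      intro j
      set τ : UnitAddTorus d → ℝ := fun x =>
        ((fun y => v y j * δ y) ⋆ k) x - ((fun y => v y j) ⋆ k) x * (δ ⋆ k) x with hτdef
      have hτc : Continuous τ :=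
        (FunctionSpaces.Torus.continuous_convolution (hvI j).2.2 hkc).sub
          ((FunctionSpaces.Torus.continuous_convolution (hvI j).2.1 hkc).mul hA.continuous)
      have hDc : Continuous (FunctionSpaces.Torus.partialDeriv j (δ ⋆ k)) := (hA.partialDeriv j).continuous
      have hm : AEStronglyMeasurable (fun x => FunctionSpaces.Torus.partialDeriv j (δ ⋆ k) x * τ x) volume :=
        (hDc.mul hτc).aestronglyMeasurable
      have hfin : eLpNorm (FunctionSpaces.Torus.partialDeriv j (δ ⋆ k)) 2 volume * eLpNorm τ 2 volume ≤
          ENNReal.ofReal P * ENNReal.ofReal Q := mul_le_mul' (hPj j) (hτ j)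
      have hne : ENNReal.ofReal P * ENNReal.ofReal Q ≠ ⊤ := ENNReal.mul_ne_top ENNReal.ofReal_ne_top ENNReal.ofReal_ne_top
      calc |∫ x, FunctionSpaces.Torus.partialDeriv j (δ ⋆ k) x * τ x|
          ≤ ∫ x, |FunctionSpaces.Torus.partialDeriv j (δ ⋆ k) x * τ x| := by
            simpa only [Real.norm_eq_abs] using
              norm_integral_le_integral_norm (fun x => FunctionSpaces.Torus.partialDeriv j (δ ⋆ k) x * τ x)
        _ = (∫⁻ x, ‖FunctionSpaces.Torus.partialDeriv j (δ ⋆ k) x * τ x‖ₑ).toReal := by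
            rw [← integral_norm_eq_lintegral_enorm hm]
            rfl
        _ ≤ (eLpNorm (FunctionSpaces.Torus.partialDeriv j (δ ⋆ k)) 2 volume * eLpNorm τ 2 volume).toReal :=
            ENNReal.toReal_mono (ne_top_of_le_ne_top hne hfin)
              (lintegral_enorm_mul_le_two_two hDc.aestronglyMeasurable hτc.aestronglyMeasurable)
        _ ≤ (ENNReal.ofReal P * ENNReal.ofReal Q).toReal := ENNReal.toReal_mono hne hfin
        _ = P * Q := by rw [ENNReal.toReal_mul, ENNReal.toReal_ofReal hP0, ENNReal.toReal_ofReal hQ0]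
    calc ∑ j, |∫ x, FunctionSpaces.Torus.partialDeriv j (δ ⋆ k) x *
          (((fun y => v y j * δ y) ⋆ k) x - ((fun y => v y j) ⋆ k) x * (δ ⋆ k) x)|
        ≤ ∑ _j : d, P * Q := Finset.sum_le_sum fun j _ => hj j
      _ = Fintype.card d * P * Q := by
          rw [Finset.sum_const, Finset.card_univ, nsmul_eq_mul]
          ring
  -- (b) the resolved dissipation, `∫ ‖∇A‖² = ∑ⱼ ‖∂ⱼA‖²_{L²} ≤ d P²`
  have hb : ∫ x, ‖FunctionSpaces.Torus.gradient (δ ⋆ k) x‖ ^ 2 ≤ Fintype.card d * P ^ 2 := by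
    have hpt : ∀ x, ‖FunctionSpaces.Torus.gradient (δ ⋆ k) x‖ ^ 2 =
        ∑ j, FunctionSpaces.Torus.partialDeriv j (δ ⋆ k) x ^ 2 := by
      intro x
      rw [EuclideanSpace.norm_sq_eq]
      refine Finset.sum_congr rfl fun j _ => ?_
      rw [FunctionSpaces.Torus.gradient_apply hA1, Real.norm_eq_abs, sq_abs]
    have hDc : ∀ j, Continuous (FunctionSpaces.Torus.partialDeriv j (δ ⋆ k)) := fun j =>
      (hA.partialDeriv j).continuous
    have hj : ∀ j, ∫ x, FunctionSpaces.Torus.partialDeriv j (δ ⋆ k) x ^ 2 ≤ P ^ 2 := by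
      intro j
      have e := Torus.lintegral_enorm_sq_eq_ofReal_integral_sq (hDc j)
      have h2 : ENNReal.ofReal (∫ x, FunctionSpaces.Torus.partialDeriv j (δ ⋆ k) x ^ 2) ≤ ENNReal.ofReal (P ^ 2) := by
        rw [← e, ← PassiveScalarProofs.eLpNorm_two_pow_two, ENNReal.ofReal_pow hP0]
        gcongr
        exact hPj j
      exact (ENNReal.ofReal_le_ofReal_iff (sq_nonneg P)).1 h2
    calc ∫ x, ‖FunctionSpaces.Torus.gradient (δ ⋆ k) x‖ ^ 2
        = ∫ x, ∑ j, FunctionSpaces.Torus.partialDeriv j (δ ⋆ k) x ^ 2 :=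
          integral_congr_ae (Eventually.of_forall hpt)
      _ = ∑ j, ∫ x, FunctionSpaces.Torus.partialDeriv j (δ ⋆ k) x ^ 2 :=
          integral_finsetSum _ fun j _ => ((hDc j).pow 2).integrable_unitAddTorus
      _ ≤ ∑ _j : d, P ^ 2 := Finset.sum_le_sum fun j _ => hj j
      _ = Fintype.card d * P ^ 2 := by
          rw [Finset.sum_const, Finset.card_univ, nsmul_eq_mul]
  have ha' := (neg_le_abs _).trans ha
  have hb' := mul_le_mul_of_nonneg_left hb hκ
  linarith

end Slice

end NikolskiiCorner

/-! ## The dissipation bound at a fixed scale, Nikol'skii corner -/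

/-- **The bound (5.10) at `t = 0`, Nikol'skii corner** (barrier audit 2026-08-17, scope caveat
(viii) of `DrivasElgindiIyerJeong2022_thm4`): as
`DrivasElgindiIyerJeong2022_thm4.two_mul_eScalarDissipation_le`, with the sup-norm Hölder
hypotheses on the scalar (`‖θ₀‖_{C^{0,β}} ≤ M`, `ess sup_t ‖θ(t)‖_{C^{0,β}} ≤ M`) replaced by
mean-square ones — `[θ₀]_{B^β_{2,∞}} ≤ M` and `ess sup_t [θ(t)]_{B^β_{2,∞}} ≤ M`
(`eBesovSupSeminorm β 2`, the Nikol'skii seminorm of the `L²` translation modulus) — plus the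
qualitative continuity of `θ₀` and of `θ(t)` for a.e. `t` (used only to run the slice identity;
no bound enters). Same right-hand side:
`2κ ∫₀ᵀ ‖∇θ‖²_{L²} ≤ M² ε^{2β} + 2 (2 d C₁ M² ε^{α+2β-1} K + T κ d C₁² M² ε^{2β-2})`.
[cite: DrivasEtAl2022, proof of Thm. 4, (5.9)–(5.10)] -/
theorem two_mul_eScalarDissipation_le_nikolskii {d : Type*} [Fintype d]
    [DecidableEq d] {T : ℝ} (hT : 0 < T) {α β : ℝ≥0} (hβ : 0 < β) {K M : ℝ≥0}
    {u : ℝ → UnitAddTorus d → EuclideanSpace ℝ d} (hu : MemLpHolder 1 α u (Ioo 0 T))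
    (huK : eLpHolderNorm 1 α u (Ioo 0 T) ≤ K) {θ₀ : UnitAddTorus d → ℝ} (hθ₀c : Continuous θ₀)
    (hθ₀N : eBesovSupSeminorm (β : ℝ) 2 θ₀ volume ≤ M) {κ : ℝ} (hκ : 0 < κ)
    {θ : ℝ → UnitAddTorus d → ℝ} (hθ : Torus.IsWeakScalarTransportOn T κ u θ₀ θ)
    (henergy : ∀ᵐ t ∂((volume : Measure ℝ).restrict (Ioo 0 T)),
      (∫⁻ x, ‖θ t x‖ₑ ^ 2) + 2 * Torus.eScalarDissipation κ θ 0 t ≤ ∫⁻ x, ‖θ₀ x‖ₑ ^ 2)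
    (hcont : ∀ᵐ t ∂((volume : Measure ℝ).restrict (Ioo 0 T)), Continuous (θ t))
    (hbound : ∀ᵐ t ∂((volume : Measure ℝ).restrict (Ioo 0 T)),
      eBesovSupSeminorm (β : ℝ) 2 (θ t) volume ≤ M)
    {ε : ℝ} (hε : 0 < ε) (hε' : ε ≤ 1 / 4) :
    2 * Torus.eScalarDissipation κ θ 0 T ≤ ENNReal.ofReal
      ((M : ℝ) ^ 2 * ε ^ (2 * (β : ℝ)) +
        2 * ((2 * Fintype.card d * Torus.gradProfileMass d * (M : ℝ) ^ 2 * ε ^ ((α : ℝ) + 2 * β - 1)) * K +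
          T * (κ * (Fintype.card d * (Torus.gradProfileMass d ^ 2 * (M : ℝ) ^ 2 * ε ^ (2 * (β : ℝ) - 2)))))) := by
  -- the `L²` modulus at scale `ε` from the Nikol'skii seminorm
  have modulus : ∀ {f : UnitAddTorus d → ℝ}, eBesovSupSeminorm (β : ℝ) 2 f volume ≤ M →
      ∀ y : UnitAddTorus d, ‖y‖ ≤ ε →
        eLpNorm (fun x => f (x - y) - f x) 2 volume ≤ ENNReal.ofReal (M * ε ^ (β : ℝ)) := by
    intro f hf y hy
    refine (Torus.eLpNorm_comp_sub_sub_le_eBesovSupSeminorm (by exact_mod_cast hβ) hy).trans ?_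
    rw [ENNReal.ofReal_mul (NNReal.coe_nonneg M), ENNReal.ofReal_coe_nnreal]
    exact mul_le_mul_left hf _
  have hθ₀i : Integrable θ₀ volume := hθ₀c.integrable_unitAddTorus
  set k : UnitAddTorus d → ℝ := Torus.kernel ε with hk_def
  have hk : Torus.IsSmooth k := Torus.isSmooth_kernel hε hε'
  -- constants and exponent bookkeeping
  set C₁ : ℝ := Torus.gradProfileMass d with hC₁
  have hC₁0 : 0 ≤ C₁ := Torus.gradProfileMass_nonneg
  set c₁ : ℝ := 2 * Fintype.card d * C₁ * (M : ℝ) ^ 2 * ε ^ ((α : ℝ) + 2 * β - 1) with hc₁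
  set c₂ : ℝ := κ * (Fintype.card d * (C₁ ^ 2 * (M : ℝ) ^ 2 * ε ^ (2 * (β : ℝ) - 2))) with hc₂
  have hc₁0 : 0 ≤ c₁ := by positivity
  have hc₂0 : 0 ≤ c₂ := by positivity
  have i1 : ((M : ℝ) * ε ^ (β : ℝ)) ^ 2 = (M : ℝ) ^ 2 * ε ^ (2 * (β : ℝ)) := by
    rw [mul_pow, ← Real.rpow_natCast (ε ^ (β : ℝ)) 2, ← Real.rpow_mul hε.le]
    congr 2
    push_cast
    ring
  have i2 : ε⁻¹ * ε ^ (β : ℝ) * ε ^ (α : ℝ) * ε ^ (β : ℝ) = ε ^ ((α : ℝ) + 2 * β - 1) := by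
    rw [← Real.rpow_neg_one ε, ← Real.rpow_add hε, ← Real.rpow_add hε, ← Real.rpow_add hε]
    congr 1
    ring
  have i3 : (ε⁻¹ * ε ^ (β : ℝ)) ^ 2 = ε ^ (2 * (β : ℝ) - 2) := by
    rw [← Real.rpow_neg_one ε, ← Real.rpow_add hε, ← Real.rpow_natCast _ 2, ← Real.rpow_mul hε.le]
    congr 1
    push_cast
    ring
  -- Step 1: the slice bound, for a.e. `s`
  have hslice : ∀ᵐ s ∂((volume : Measure ℝ).restrict (Ioo 0 T)),
      -(∫ x, ((θ s) ⋆ k) x * ∫ y, θ s y *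
        (-⟪u s y, Torus.gradient k (x - y)⟫_ℝ + κ * Torus.laplacian k (x - y))) ≤
        c₁ * boundedHolderNorm α (u s) + c₂ := by
    filter_upwards [hbound, hcont, hu.1, hθ.ae_isWeaklyDivFree, hθ.ae_aestronglyMeasurable_velocity_slice]
      with s hsM hθsc hsu hdiv hum
    have huH : HolderWith (nnHolderNorm α (u s)) α (u s) := hsu.memHolder.holderWith
    have hCv : ∀ y, ‖u s y‖ ≤ (eSupNorm (u s)).toReal := fun y => by
      rw [← toReal_enorm]
      exact ENNReal.toReal_mono hsu.eSupNorm_lt_top.ne (enorm_le_eSupNorm (u s) y)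
    have hle : ((nnHolderNorm α (u s) : ℝ≥0) : ℝ) ≤ boundedHolderNorm α (u s) :=
      ENNReal.toReal_mono hsu.ne (eHolderNorm_le_eBoundedHolderNorm α (u s))
    have h := NikolskiiCorner.neg_integral_conv_mul_flux_le_of_sqModulus hθsc (modulus hsM) hum hCv huH
      hdiv hε hε' hκ.le
    have hn0 : 0 ≤ ((nnHolderNorm α (u s) : ℝ≥0) : ℝ) := NNReal.coe_nonneg _
    calc _ ≤ _ := h
      _ = c₁ * ((nnHolderNorm α (u s) : ℝ≥0) : ℝ) + c₂ := by
          rw [hc₁, hc₂, ← i2, ← i3]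
          ring
      _ ≤ c₁ * boundedHolderNorm α (u s) + c₂ := by gcongr
  -- Step 2: the time integral of the slice bound, in `ℝ≥0∞`
  have hKint : ∫⁻ s in Ioo 0 T, ENNReal.ofReal (boundedHolderNorm α (u s)) ≤ K := by
    have e : ∫⁻ s in Ioo 0 T, ENNReal.ofReal (boundedHolderNorm α (u s)) = eLpHolderNorm 1 α u (Ioo 0 T) := by
      rw [eLpHolderNorm, eLpNorm_one_eq_lintegral_enorm]
      refine lintegral_congr fun s => ?_
      exact (Real.enorm_eq_ofReal ENNReal.toReal_nonneg).symm
    rw [e]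
    exact huK
  have htime : ∀ t ∈ Ioo 0 T,
      ENNReal.ofReal (∫ s in Ioc 0 t, -(∫ x, ((θ s) ⋆ k) x * ∫ y, θ s y *
        (-⟪u s y, Torus.gradient k (x - y)⟫_ℝ + κ * Torus.laplacian k (x - y)))) ≤
        ENNReal.ofReal c₁ * K + ENNReal.ofReal c₂ * ENNReal.ofReal T := by
    intro t ht
    refine (ofReal_integral_le_lintegral_ofReal _).trans ?_
    refine (lintegral_mono_set (Ioc_subset_Ioo_right ht.2)).trans ?_
    have hmono : ∫⁻ s in Ioo 0 T, ENNReal.ofReal (-(∫ x, ((θ s) ⋆ k) x * ∫ y, θ s y *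
        (-⟪u s y, Torus.gradient k (x - y)⟫_ℝ + κ * Torus.laplacian k (x - y)))) ≤
        ∫⁻ s in Ioo 0 T, (ENNReal.ofReal c₁ * ENNReal.ofReal (boundedHolderNorm α (u s)) + ENNReal.ofReal c₂) := by
      refine lintegral_mono_ae (hslice.mono fun s hs => ?_)
      have hb0 : 0 ≤ boundedHolderNorm α (u s) := ENNReal.toReal_nonneg
      rw [← ENNReal.ofReal_mul hc₁0, ← ENNReal.ofReal_add (mul_nonneg hc₁0 hb0) hc₂0]
      exact ENNReal.ofReal_le_ofReal hs
    refine hmono.trans ?_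
    rw [lintegral_add_right _ measurable_const, lintegral_const_mul' _ _ ENNReal.ofReal_ne_top,
      lintegral_const, Measure.restrict_apply_univ, Real.volume_Ioo, sub_zero]
    gcongr
  -- Step 3: the bound for a.e. `t`
  have hmain : ∀ᵐ t ∂((volume : Measure ℝ).restrict (Ioo 0 T)), 2 * Torus.eScalarDissipation κ θ 0 t ≤
      ENNReal.ofReal ((M : ℝ) ^ 2 * ε ^ (2 * (β : ℝ))) + 2 * (ENNReal.ofReal c₁ * K + ENNReal.ofReal c₂ * ENNReal.ofReal T) := by
    filter_upwards [henergy, hθ.ae_integral_sq_molInt_eq hθ₀i hk, ae_restrict_mem measurableSet_Ioo,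
      hθ.ae_slice_integrable₁] with t hen hid htT hint
    have hθti : Integrable (θ t) volume := hint.1
    have hAc : Continuous ((θ t) ⋆ k) := Torus.continuous_convolution hθti hk.continuous
    -- Young: `‖θ(t) ⋆ k‖₂ ≤ ‖θ(t)‖₂`
    have hY : ∫⁻ x, ‖((θ t) ⋆ k) x‖ₑ ^ 2 ≤ ∫⁻ x, ‖θ t x‖ₑ ^ 2 := by
      rw [← PassiveScalarProofs.eLpNorm_two_pow_two, ← PassiveScalarProofs.eLpNorm_two_pow_two]
      gcongr
      calc eLpNorm ((θ t) ⋆ k) 2 volume ≤ (∫⁻ y, ‖k y‖ₑ) * eLpNorm (θ t) 2 volume :=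
            Torus.eLpNorm_convolution_le hθti.aestronglyMeasurable hk.continuous.aestronglyMeasurable one_le_two
        _ = eLpNorm (θ t) 2 volume := by rw [hk_def, Torus.lintegral_enorm_kernel hε hε', one_mul]
    have e0 : ∫⁻ x, ‖θ₀ x‖ₑ ^ 2 = ENNReal.ofReal (∫ x, θ₀ x ^ 2) :=
      Torus.lintegral_enorm_sq_eq_ofReal_integral_sq hθ₀c
    have eA : ∫⁻ x, ‖((θ t) ⋆ k) x‖ₑ ^ 2 = ENNReal.ofReal (∫ x, ((θ t) ⋆ k) x ^ 2) :=
      Torus.lintegral_enorm_sq_eq_ofReal_integral_sq hAc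
    have h1 : ENNReal.ofReal (∫ x, ((θ t) ⋆ k) x ^ 2) + 2 * Torus.eScalarDissipation κ θ 0 t ≤
        ENNReal.ofReal (∫ x, θ₀ x ^ 2) := by
      rw [← eA, ← e0]
      exact (add_le_add hY le_rfl).trans hen
    have h2 : 2 * Torus.eScalarDissipation κ θ 0 t ≤
        ENNReal.ofReal ((∫ x, θ₀ x ^ 2) - ∫ x, ((θ t) ⋆ k) x ^ 2) := by
      rw [ENNReal.ofReal_sub _ (integral_nonneg fun x => sq_nonneg _)]
      exact ENNReal.le_sub_of_add_le_left ENNReal.ofReal_ne_top h1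
    have h3 : (∫ x, θ₀ x ^ 2) - ∫ x, ((θ t) ⋆ k) x ^ 2 ≤ (M : ℝ) ^ 2 * ε ^ (2 * (β : ℝ)) +
        2 * ∫ s in Ioc 0 t, -(∫ x, ((θ s) ⋆ k) x * ∫ y, θ s y *
          (-⟪u s y, Torus.gradient k (x - y)⟫_ℝ + κ * Torus.laplacian k (x - y))) := by
      rw [hid, integral_neg, ← i1]
      have hc := NikolskiiCorner.integral_sq_sub_integral_convolution_sq_le_of_modulus hθ₀c hε hε'
        ENNReal.ofReal_ne_top (modulus hθ₀N)
      rw [ENNReal.toReal_ofReal (by positivity)] at hc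
      linarith
    calc 2 * Torus.eScalarDissipation κ θ 0 t
        ≤ ENNReal.ofReal ((∫ x, θ₀ x ^ 2) - ∫ x, ((θ t) ⋆ k) x ^ 2) := h2
      _ ≤ ENNReal.ofReal ((M : ℝ) ^ 2 * ε ^ (2 * (β : ℝ)) +
          2 * ∫ s in Ioc 0 t, -(∫ x, ((θ s) ⋆ k) x * ∫ y, θ s y *
            (-⟪u s y, Torus.gradient k (x - y)⟫_ℝ + κ * Torus.laplacian k (x - y)))) :=
          ENNReal.ofReal_le_ofReal h3
      _ ≤ ENNReal.ofReal ((M : ℝ) ^ 2 * ε ^ (2 * (β : ℝ))) +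
          ENNReal.ofReal (2 * ∫ s in Ioc 0 t, -(∫ x, ((θ s) ⋆ k) x * ∫ y, θ s y *
            (-⟪u s y, Torus.gradient k (x - y)⟫_ℝ + κ * Torus.laplacian k (x - y)))) :=
          ENNReal.ofReal_add_le
      _ ≤ _ := by
          rw [ENNReal.ofReal_mul zero_le_two, ENNReal.ofReal_ofNat]
          gcongr
          exact htime t htT
  -- Step 4: from a.e. `t` to `T`
  have h2D : ∀ t, 2 * Torus.eScalarDissipation κ θ 0 t =
      ∫⁻ s in Ioo 0 t, 2 * (ENNReal.ofReal κ * Torus.eScalarGradNormSq (θ s)) := fun t => by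
    rw [Torus.eScalarDissipation, ← lintegral_const_mul' _ _ ENNReal.ofReal_ne_top,
      ← lintegral_const_mul' _ _ ENNReal.ofNat_ne_top]
  have hfin : 2 * Torus.eScalarDissipation κ θ 0 T ≤
      ENNReal.ofReal ((M : ℝ) ^ 2 * ε ^ (2 * (β : ℝ))) + 2 * (ENNReal.ofReal c₁ * K + ENNReal.ofReal c₂ * ENNReal.ofReal T) := by
    rw [h2D]
    refine setLIntegral_Ioo_le_of_ae_le hT ?_
    filter_upwards [hmain] with t ht
    rwa [h2D] at ht
  refine hfin.trans (le_of_eq ?_)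
  rw [ENNReal.ofReal_add (by positivity) (by positivity), ENNReal.ofReal_mul zero_le_two, ENNReal.ofReal_ofNat,
    ENNReal.ofReal_add (by positivity) (by positivity), ENNReal.ofReal_mul hc₁0, ENNReal.ofReal_coe_nnreal,
    ENNReal.ofReal_mul (le_of_lt hT), mul_comm (ENNReal.ofReal T) (ENNReal.ofReal c₂)]

/-! ## The theorem, Nikol'skii corner -/

/-- **The Obukhov–Corrsin threshold with mean-square (`L²`-Besov) scalar regularity** (barrier
audit 2026-08-17: scope caveat (viii) of `DrivasElgindiIyerJeong2022_thm4` made a theorem). Same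
statement and constant as the named fact `DrivasElgindiIyerJeong2022_thm4` /
`DrivasElgindiIyerJeong2022_thm4_holds` — `u ∈ L¹(0,T; C^{0,α})`, `‖u‖_{L¹C^{0,α}} ≤ K`, weak
solutions obeying the energy balance, `0 < κ ≤ κ₀`, dissipation `≤ C κ^{(α+2β-1)/(α+1)}` with
`C = C(d, T, α, β, K, M, κ₀)` — except that the sup-norm Hölder bounds on the SCALAR,
`‖θ₀‖_{C^{0,β}} ≤ M` and `ess sup_t ‖θ(t)‖_{C^{0,β}} ≤ M`, are replaced by bounds on the
Nikol'skii seminorm of the `L²` translation modulus, `[θ₀]_{B^β_{2,∞}} ≤ M` and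
`ess sup_t [θ(t)]_{B^β_{2,∞}} ≤ M` (`eBesovSupSeminorm β 2 · volume`, `BesovDifference`;
`B^β_{2,∞} ⊋ C^{0,β}` on the torus), together with the qualitative continuity of `θ₀` and of
`θ(t)` for a.e. `t` (no bound; needed only to run the slice identity of
`PassiveScalarEnergySlice`). Consequently spatial intermittency of the scalar — Hölder norms
blowing up along a vanishing-diffusivity family while one mean-square exponent `β > (1-α)/2`
stays bounded — does not evade the obstruction: the scalar pairs with itself twice and with the
velocity once, so Cauchy–Schwarz (`L² × L²`, sup on `u`) replaces the `sup × L¹` pairing of the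
printed proof; this is the end `(p,q) = (2,∞)` of the scale `θ ∈ B^β_{p,∞}`, `u ∈ B^α_{q,∞}`,
`2/p + 1/q = 1` whose other end `(∞,1)` is `DrivasElgindiIyerJeong2022_thm4_besov`, cf. the
inviscid conservation theorem in that scale. [cite: DrivasEtAl2022, Thm. 4 and its proof]
[cite: AkramovWiedemann2019, Thm. 1] -/
theorem DrivasElgindiIyerJeong2022_thm4_nikolskii (d : Type) [Fintype d] [DecidableEq d] (T : ℝ)
    (hT : 0 < T) (α β : ℝ≥0) (hα : 0 < α ∧ α ≤ 1) (hβ : 0 < β ∧ β ≤ 1) (K M κ₀ : ℝ≥0) :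
    ∃ C : ℝ≥0,
      ∀ (u : ℝ → UnitAddTorus d → EuclideanSpace ℝ d) (_hu : MemLpHolder 1 α u (Ioo 0 T))
        (_huK : eLpHolderNorm 1 α u (Ioo 0 T) ≤ K)
        (θ₀ : UnitAddTorus d → ℝ) (_hθ₀c : Continuous θ₀)
        (_hθ₀ : eBesovSupSeminorm (β : ℝ) 2 θ₀ volume ≤ M)
        (κ : ℝ) (_hκ : 0 < κ) (_hκ₀ : κ ≤ κ₀)
        (θ : ℝ → UnitAddTorus d → ℝ) (_hθ : Torus.IsWeakScalarTransportOn T κ u θ₀ θ)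
        (_henergy : ∀ᵐ t ∂(volume.restrict (Ioo 0 T)),
          (∫⁻ x, ‖θ t x‖ₑ ^ 2) + 2 * Torus.eScalarDissipation κ θ 0 t ≤ ∫⁻ x, ‖θ₀ x‖ₑ ^ 2)
        (_hcont : ∀ᵐ t ∂(volume.restrict (Ioo 0 T)), Continuous (θ t))
        (_hbound : ∀ᵐ t ∂(volume.restrict (Ioo 0 T)), eBesovSupSeminorm (β : ℝ) 2 (θ t) volume ≤ M),
        Torus.eScalarDissipation κ θ 0 T ≤
          ENNReal.ofReal (C * κ ^ (((α : ℝ) + 2 * β - 1) / (α + 1))) := by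
  rcases eq_zero_or_pos κ₀ with hκ₀ | hκ₀
  · refine ⟨0, ?_⟩
    intro u _ _ θ₀ _ _ κ hκ hκκ₀
    exact absurd (hκ.trans_le hκκ₀) (by simp [hκ₀])
  -- the scale `ε = c κ^γ`
  set γ : ℝ := ((α : ℝ) + 1)⁻¹ with hγ
  have hα1pos : (0 : ℝ) < α + 1 := by positivity
  have hγ0 : 0 ≤ γ := by positivity
  have hκ₀' : (0 : ℝ) < κ₀ := hκ₀
  set c : ℝ := 4⁻¹ * (κ₀ : ℝ) ^ (-γ) with hc
  have hc0 : 0 < c := by positivity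
  set C₁ : ℝ := Torus.gradProfileMass d with hC₁
  have hC₁0 : 0 ≤ C₁ := Torus.gradProfileMass_nonneg
  set Cr : ℝ := 2⁻¹ * ((M : ℝ) ^ 2 * (c ^ (2 * (β : ℝ)) * (κ₀ : ℝ) ^ ((1 - (α : ℝ)) * γ)) +
      (2 * (2 * Fintype.card d * C₁ * (M : ℝ) ^ 2) * K) * c ^ ((α : ℝ) + 2 * β - 1) +
      (2 * (T * (Fintype.card d * (C₁ ^ 2 * (M : ℝ) ^ 2)))) * c ^ (2 * (β : ℝ) - 2)) with hCr
  have hCr0 : 0 ≤ Cr := by positivity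
  refine ⟨Cr.toNNReal, ?_⟩
  intro u hu huK θ₀ hθ₀c hθ₀ κ hκ hκκ₀ θ hθ henergy hcont hbound
  set ε : ℝ := c * κ ^ γ with hε_def
  have hε : 0 < ε := by positivity
  have hε' : ε ≤ 1 / 4 := by
    have h1 : κ ^ γ ≤ (κ₀ : ℝ) ^ γ := Real.rpow_le_rpow hκ.le (by exact_mod_cast hκκ₀) hγ0
    have h2 : (κ₀ : ℝ) ^ (-γ) * (κ₀ : ℝ) ^ γ = 1 := by
      rw [Real.rpow_neg hκ₀'.le, inv_mul_cancel₀ (Real.rpow_pos_of_pos hκ₀' γ).ne']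
    calc ε = 4⁻¹ * ((κ₀ : ℝ) ^ (-γ) * κ ^ γ) := by rw [hε_def, hc, mul_assoc]
      _ ≤ 4⁻¹ * ((κ₀ : ℝ) ^ (-γ) * (κ₀ : ℝ) ^ γ) := by gcongr
      _ = 1 / 4 := by rw [h2]; norm_num
  have hraw := two_mul_eScalarDissipation_le_nikolskii hT hβ.1 hu huK hθ₀c hθ₀ hκ hθ
    henergy hcont hbound hε hε'
  -- optimisation in `ℓ`
  have hscale := scale_bound (β := (β : ℝ)) (2 * (2 * Fintype.card d * C₁ * (M : ℝ) ^ 2) * K)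
    (2 * (T * (Fintype.card d * (C₁ ^ 2 * (M : ℝ) ^ 2)))) (by exact_mod_cast hα.2) hα1pos hκ
    (by exact_mod_cast hκκ₀) hc0 hγ (sq_nonneg (M : ℝ))
  have hreal : (M : ℝ) ^ 2 * ε ^ (2 * (β : ℝ)) +
      2 * ((2 * Fintype.card d * C₁ * (M : ℝ) ^ 2 * ε ^ ((α : ℝ) + 2 * β - 1)) * K +
        T * (κ * (Fintype.card d * (C₁ ^ 2 * (M : ℝ) ^ 2 * ε ^ (2 * (β : ℝ) - 2))))) ≤
      2 * ((Cr.toNNReal : ℝ≥0) * κ ^ (((α : ℝ) + 2 * β - 1) / (α + 1))) := by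
    rw [Real.coe_toNNReal _ hCr0, hCr]
    calc _ = (M : ℝ) ^ 2 * (c * κ ^ γ) ^ (2 * (β : ℝ)) +
          2 * (2 * Fintype.card d * C₁ * (M : ℝ) ^ 2) * K * (c * κ ^ γ) ^ ((α : ℝ) + 2 * β - 1) +
          2 * (T * (Fintype.card d * (C₁ ^ 2 * (M : ℝ) ^ 2))) * (κ * (c * κ ^ γ) ^ (2 * (β : ℝ) - 2)) := by
          rw [hε_def]; ring
      _ ≤ _ := hscale
      _ = _ := by ring
  calc Torus.eScalarDissipation κ θ 0 T
      ≤ 2⁻¹ * (2 * Torus.eScalarDissipation κ θ 0 T) := by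
        rw [← mul_assoc, ENNReal.inv_mul_cancel two_ne_zero ENNReal.ofNat_ne_top, one_mul]
    _ ≤ 2⁻¹ * ENNReal.ofReal (2 * ((Cr.toNNReal : ℝ≥0) * κ ^ (((α : ℝ) + 2 * β - 1) / (α + 1)))) := by
        gcongr
        exact hraw.trans (ENNReal.ofReal_le_ofReal hreal)
    _ = ENNReal.ofReal ((Cr.toNNReal : ℝ≥0) * κ ^ (((α : ℝ) + 2 * β - 1) / (α + 1))) := by
        rw [ENNReal.ofReal_mul zero_le_two, ENNReal.ofReal_ofNat, ← mul_assoc,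
          ENNReal.inv_mul_cancel two_ne_zero ENNReal.ofNat_ne_top, one_mul]

end Literature.Barriers.AnomalousDissipation

end
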